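import Literature.Barriers.CriticalPhenomena.RigorousRGSmallParameterCovarianceDecay
import Literature.Barriers.CriticalPhenomena.RigorousRGSmallParameterCovarianceGradientBound
import Literature.Barriers.CriticalPhenomena.RigorousRGSmallParameterFlowExponent
import Literature.Barriers.CriticalPhenomena.RigorousRGSmallParameterChangeOfVariables
import HarnessLib

/-!
# `RigorousRGSmallParameter` (Slade, Theorem 1.4.1): the perturbative coefficients of §5.1–§5.2
# for the explicit covariance decomposition, and Lemma 5.2.1 (the bounds on `η_j, η_{≥j}, β_j,
# β^:_j, w̄_j^{(1)}` and their continuity in `m²`)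

Companion ("proof architecture") file of
`Literature/Barriers/CriticalPhenomena/RigorousRGSmallParameter.lean` (the barrier is literally
`LongRangePhi4.Slade2017_thm141`), one printed layer above the covariance files
(`RigorousRGSmallParameterCovarianceBound.lean`: Proposition 3.3.1 (3.9) for `C_j = FRD.fracCov`;
`RigorousRGSmallParameterCovarianceDecay.lean`: finite range, the `m̄²`-domination of the second
term of (3.9); `RigorousRGSmallParameterCovarianceDecomposition.lean`: continuity in `m²`) and
feeding the abstract flow files (`RigorousRGSmallParameterFlowToMassScale.lean`, Theorem 7.2.2,
takes `|β_j| ≤ B_β`, the `β^:_j` and `Π = sup|ξ̃_j|` as hypotheses `CriticalFlow.Hyp`;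
`RigorousRGSmallParameterFlowExponent.lean`, Lemma 8.1.1, takes `|β_k|, |β^:_k| ≤ B`;
`RigorousRGSmallParameterChangeOfVariables.lean` defines the abstract `betaW`, `xiW` of §5.2–§5.3).
Source: G. Slade, *Critical exponents for long-range `O(n)` models below the upper critical
dimension*, Commun. Math. Phys. **358** (2018) 343–436, arXiv:1611.06169, §5.1 (the coefficients
of the second-order map `Φ_pt`, display (5.1)–(5.5)), §5.2 (the rescaled coefficients (5.18)–(5.21),
`M_j = (1+m²L^{α(j-1)})^{-2}`, Lemma 5.2.1) and §10.2 (proof of Lemma 5.2.1); the mass scale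
`j_m` of §3.4 is `LongRangePhi4.massScale` (file `…FlowExponent.lean`).

## The printed statement and proof

**Lemma 5.2.1.** "Let `d = 1,2,3`; `α ∈ (½d, 2∧d)`; `j ≥ 1`; `m̄² > 0`. The following bounds hold
uniformly in `m² ∈ [0,m̄²]`: (5.22) `η_j, η_{≥j}, β_j, β^:_j, ξ_j, ξ^W_j = O(M_j)`, `w̄_j^{(1)} = O(1)`,
`υ_{*,j} = O(M_jL^{-dj})`. Constants in (5.22) may depend on `L, m̄²` but not on `j`, except in the
bound on `ξ_j` where the constant is also independent of `L`. Each of the left-hand sides in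
(5.22) is continuous in `m² ∈ [0,m̄²]`. Moreover … (5.23) [the bound on `∂β_j/∂m²`]." Proof
(§10.2): "The claimed continuity in `m²` is a consequence of the definitions together with the
continuity of `C_j` given by Proposition 3.3.1. … Due to the assumption that `m² ≤ m̄²`, the last
term on the right-hand side of (3.9) can be ignored since it can be dominated by the first term.
*Bound on `η_j, η_{≥j}`.* It follows immediately from the definitions … together with the bound
(3.9) on the covariance, that `η_j = (n+2)L^{(d-α)j}C_{j+1;0,0} ≲ M_j`, with a constant that is
independent of `L`. The desired bound on `η_{≥j}` then follows as well. *Bound on `w_j^{(1)}`.* By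
definition, and by (3.9), `|w_j^{(1)}| ≤ Σ_xΣ_{k=1}^j|C_{k;0,x}| ≲ Σ_{k=1}^j L^{dk}M_kL^{-(d-α)k} ≲
L^{α(j∧j_m)}`. *Bound on `β_j, β^:_j`.* By definition, `β'_j` is proportional to
`w_+^{(2)} - w^{(2)} = 2(wC)^{(1)} + C^{(2)} ≤ 2Σ_x C_{j+1;0,x}Σ_{k=1}^{j+1}C_{k;0,x}`. Therefore, using the
finite range of `C_k`, `β'_j ≲ M_jL^{-(d-α)j}Σ_{k=0}^jL^{dk}M_kL^{-(d-α)k} ≲ M_jL^{-(d-α)j}L^{α(j∧j_m)}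
≤ M_jL^{ε(j∧j_m)}`. This proves (5.22) for `β_j = L^{-ε(j∧j_m)}β'_j`. The bound on `β^:_j` then follows
from the bounds on `η_{≥j}, w̄_j^{(1)}`."

## What this file does (everything is proved; no named fact is introduced)

Definitions (namespace `LongRangePhi4.PT`), for the decomposition `C_j = FRD.fracCov d L α m² j`
of `((-Δ_{ℤ^d})^{α/2}+m²)⁻¹` ("Throughout Section 5, the covariance decomposition is for `ℤ^d`
rather than for the torus"): `massFactor` (`M_j`), `scaleMin` (`j ∧ j_m`, with `j_m = ∞` for
`m² = 0`), `box`/`ball` (finite sets of sites), `wCov` (`w_j = Σ_{i=1}^jC_i`, §4.3), `powSum`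
(`q^{(n)} = Σ_xq_x^n`, (5.3)), `etaPrime` (`η'_j = (n+2)C_{j+1;0,0}`), `etaCoeff`
(`η_j = L^{(d-α)j}η'_j`), `etaGe` (`η_{≥j} = Σ_{k≥j}L^{-(d-α)(k-j)}η_k`), `wOne` (`w_j^{(1)}`),
`wbarOne` (`w̄_j^{(1)} = L^{-α(j∧j_m)}w_j^{(1)}`), `betaPrime` (`β'_j = (n+8)δ[w^{(2)}]`), `betaCoeff`
(`β_j = L^{-ε(j∧j_m)}β'_j`), `betaWCoeff` (`β^:_j`, through the abstract `betaW`).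

Theorems:
* `abs_fracCov_le_massFactor` — (3.9) for `m² ≤ m̄²` in the form `|C_{j;0,x}| ≤ c(L^{j-1})^{α-d}M_j`
  (`c` depending on `d, α, m̄²` only).
* `one_le_mass_mul_rpow_massScale` (`m²L^{α(j_m-1)} ≥ 1`), `massFactor_le_of_massScale_le`
  ((5.21): `M_k ≤ L^{-2α(k-j_m)}`), `sum_pow_mul_massFactor_le` (the scale sum
  `Σ_{k≤j}(L^α)^kM_k ≤ 2K_α(L^α)^{j∧j_m}`, `K_α = 2^α/(2^α-1)`, uniformly in `L ≥ 2`).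
* `card_ball_le` (`#{|x|₁ < R} ≤ (2R+1)^d`), `sum_abs_fracCov_le` (`Σ_x|C_{k;0,x}| ≤ cL^d(L^α)^kM_k`),
  `sum_abs_wCov_le` (the `ℓ¹` norm of `w_j`), `powSum_two_succ_sub` ((10.28)).
* **Lemma 5.2.1:** `abs_etaCoeff_le` (`|η_j| ≤ cM_j`, `c` independent of `L`),
  `summable_etaGe_and_abs_le` (`|η_{≥j}| ≤ cM_j`, uniformly in `L ≥ 2`), `abs_wbarOne_le`
  (`|w̄_j^{(1)}| ≤ cL^d`), `abs_betaCoeff_le` (`|β'_j| ≤ cL^{d+α}M_j(L^ε)^{j∧j_m}`, `|β_j| ≤ cL^{d+α}M_j`),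
  `abs_betaWCoeff_le` (`|β^:_j| ≤ c_LM_j`), packaged as `Slade2017_lem521_core`; proved for all
  `d ≥ 1`, `0 < α < 2 ∧ d`, `L ≥ 2`, `m̄² ≥ 0`, and ALL scales `j ≥ 0` (the printed `d ≤ 3`,
  `α > d/2`, `j ≥ 1` are not needed for these five bounds).
* **Continuity in `m²`:** `continuous_wCov_mass`, `continuous_powSum_wCov_mass`,
  `continuous_etaCoeff_mass`, `continuousOn_etaGe_mass` (on `[0,m̄²]`, by uniform convergence),
  `continuous_wOne_betaPrime_mass` — the unrescaled coefficients are continuous on `ℝ`;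
  `scaleMin_eq_of_lt` (`m² < L^{-α(j-1)} ⟹ j+1 ≤ j_m`), `continuousOn_rescaled_mass`,
  `continuousOn_betaWCoeff_mass` — `β_j, w̄_j^{(1)}, w̄_{j+1}^{(1)}, β^:_j` are continuous in `m²` on
  `[0, L^{-α(j-1)})`, i.e. below the mass scale.

Scope / reading. (i) NOT treated here: `ξ_j`, `ξ^W_j`, the vacuum-energy coefficients `υ_{*,j}`
(whose bounds need the discrete Taylor expansion with `∇²C_{j+1}` and `w^{(3)}`), and the mass
derivative (5.23) (which needs the `∂/∂m²` display of Proposition 3.3.1). (ii) On the printed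
sentence "Each of the left-hand sides in (5.22) is continuous in `m² ∈ [0,m̄²]`": at a FIXED scale
`j` the rescaled coefficients `β_j = L^{-ε(j∧j_m)}β'_j`, `w̄_j^{(1)}`, `β^:_j` are locally constant
multiples of continuous functions away from the masses where `j ∧ j_m(m²)` jumps, and do jump there;
what the paper uses (proof of Lemma 7.2.1: "the nonzero `T_j` have `j ≤ j_{m̃}+1 < j_m`") is
continuity at scales below the mass scale, which is what `continuousOn_betaWCoeff_mass` states
(on `[0,L^{-α(j-1)})`, exactly the masses with `j+1 ≤ j_m`); the unrescaled coefficients are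
continuous on all of `ℝ`. (iii) Constants: as printed, the constants for `w̄^{(1)}, β, β^:` depend
on `L` (here through explicit powers `L^d`, `L^{d+α}`), those for `η, η_{≥}` do not.

Ledger effect: none on the trust base of the barrier's reduction chain (`Slade2017_prop822`
remains the named fact); this file supplies, for the explicit decomposition, the coefficient
bounds `B_β`, part of the inputs of `CriticalFlow.Hyp` and of Lemma 8.1.1.
-/

noncomputable section

namespace Literature.Barriers.CriticalPhenomena

open _root_.MeasureTheory Set Filter
open scoped _root_.Topology Real

namespace LongRangePhi4

namespace PT

open Literature.Probability.LatticeModels FRD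

variable {d : ℕ}

/-! ### The factor `M_j` -/

/-- `M_j = (1 + m²L^{α(j-1)})^{-2}` (the display before Lemma 5.2.1).
[cite: Slade2017, §5.2 (display defining `M_j`)] -/
def massFactor (L α m2 : ℝ) (j : ℕ) : ℝ := ((1 + m2 * L ^ (α * ((j : ℝ) - 1))) ^ 2)⁻¹

/-- `M_j > 0` (`m² ≥ 0`, `L > 0`). [cite: Slade2017, §5.2 (display defining `M_j`)] -/
theorem massFactor_pos {L : ℝ} (hL : 0 < L) (α : ℝ) {m2 : ℝ} (hm2 : 0 ≤ m2) (j : ℕ) :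
    0 < massFactor L α m2 j := by
  unfold massFactor
  have : 0 ≤ m2 * L ^ (α * ((j : ℝ) - 1)) := mul_nonneg hm2 (Real.rpow_nonneg hL.le _)
  positivity

/-- `M_j ≤ 1` (`m² ≥ 0`). [cite: Slade2017, §5.2 ("the left-hand side is bounded above by 1", §3.4)] -/
theorem massFactor_le_one {L : ℝ} (hL : 0 < L) (α : ℝ) {m2 : ℝ} (hm2 : 0 ≤ m2) (j : ℕ) :
    massFactor L α m2 j ≤ 1 := by
  unfold massFactor
  have : 0 ≤ m2 * L ^ (α * ((j : ℝ) - 1)) := mul_nonneg hm2 (Real.rpow_nonneg hL.le _)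
  apply inv_le_one_of_one_le₀
  nlinarith

/-- `M_{j+1} ≤ M_j` (`L ≥ 1`, `α ≥ 0`, `m² ≥ 0`). [cite: Slade2017, §5.2 (display defining `M_j`)] -/
theorem massFactor_succ_le {L : ℝ} (hL : 1 ≤ L) {α : ℝ} (hα : 0 ≤ α) {m2 : ℝ} (hm2 : 0 ≤ m2)
    (j : ℕ) : massFactor L α m2 (j + 1) ≤ massFactor L α m2 j := by
  unfold massFactor
  have hL0 : 0 < L := by linarith
  have h1 : L ^ (α * ((j : ℝ) - 1)) ≤ L ^ (α * (((j + 1 : ℕ) : ℝ) - 1)) := by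
    apply Real.rpow_le_rpow_of_exponent_le hL
    push_cast
    nlinarith
  have h0 : 0 ≤ m2 * L ^ (α * ((j : ℝ) - 1)) := mul_nonneg hm2 (Real.rpow_nonneg hL0.le _)
  have h2 : m2 * L ^ (α * ((j : ℝ) - 1)) ≤ m2 * L ^ (α * (((j + 1 : ℕ) : ℝ) - 1)) :=
    mul_le_mul_of_nonneg_left h1 hm2
  apply inv_anti₀ (by positivity)
  nlinarith

/-- `M_k ≤ M_j` for `j ≤ k`. [cite: Slade2017, §5.2 (display defining `M_j`)] -/
theorem massFactor_antitone {L : ℝ} (hL : 1 ≤ L) {α : ℝ} (hα : 0 ≤ α) {m2 : ℝ} (hm2 : 0 ≤ m2)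
    {j k : ℕ} (hjk : j ≤ k) : massFactor L α m2 k ≤ massFactor L α m2 j := by
  induction k with
  | zero =>
      have : j = 0 := Nat.le_zero.mp hjk
      subst this; exact le_rfl
  | succ k ih =>
      rcases Nat.lt_or_ge j (k + 1) with h | h
      · exact (massFactor_succ_le hL hα hm2 k).trans (ih (Nat.lt_succ_iff.mp h))
      · have : j = k + 1 := le_antisymm hjk h
        subst this; exact le_rfl

/-- For `j ≥ 1`, `M_j = (1 + m²(L^{j-1})^α)^{-2}` with a natural power. [cite: Slade2017, §5.2 (display defining `M_j`)] -/
theorem massFactor_eq {L : ℝ} (hL : 0 ≤ L) (α m2 : ℝ) {j : ℕ} (hj : 1 ≤ j) :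
    massFactor L α m2 j = ((1 + m2 * (L ^ (j - 1)) ^ α) ^ 2)⁻¹ := by
  have h : L ^ (α * ((j : ℝ) - 1)) = (L ^ (j - 1 : ℕ)) ^ α := by
    rw [← Real.rpow_natCast L (j - 1), ← Real.rpow_mul hL, Nat.cast_sub hj, Nat.cast_one, mul_comm]
  rw [massFactor, h]

/-- `1/(1+A²) ≤ 2(1+A)^{-2}` for `A ≥ 0`. [folklore] -/
theorem one_div_one_add_sq_le {A : ℝ} (hA : 0 ≤ A) : 1 / (1 + A ^ 2) ≤ 2 * ((1 + A) ^ 2)⁻¹ := by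
  have h1 : 0 < 1 + A ^ 2 := by positivity
  have h2 : 0 < (1 + A) ^ 2 := by positivity
  have e : 2 * ((1 + A) ^ 2)⁻¹ = 2 / (1 + A) ^ 2 := by rw [div_eq_mul_inv]
  rw [e, div_le_div_iff₀ h1 h2]
  nlinarith [sq_nonneg (1 - A)]

/-! ### The covariance bound (3.9) in terms of `M_j` -/

/-- **(3.9) below a fixed mass `m̄²`:** `|C_{j;0,x}(m²)| ≤ c (L^{j-1})^{α-d} M_j` for
`L ≥ 2`, `m² ∈ [0,m̄²]`, `j ≥ 1`, `x ∈ ℤ^d`, with `c` depending on `d, α, m̄²` only ("Due to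
the assumption that `m² ≤ m̄²`, the last term on the right-hand side of (3.9) can be ignored since
it can be dominated by the first term"). [cite: Slade2017, §10.2 (proof of Lemma 5.2.1, opening)] -/
theorem abs_fracCov_le_massFactor (hd : 1 ≤ d) {α : ℝ} (hα0 : 0 < α) (hα2 : α < 2) (hαd : α < d)
    {mbar : ℝ} (hmbar : 0 ≤ mbar) :
    ∃ c : ℝ, 0 < c ∧ ∀ L : ℝ, 2 ≤ L → ∀ m2 : ℝ, 0 ≤ m2 → m2 ≤ mbar → ∀ j : ℕ, 1 ≤ j →
      ∀ x : Site d, |fracCov d L α m2 j x| ≤ c * (L ^ (j - 1)) ^ (α - d) * massFactor L α m2 j := by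
  obtain ⟨c, hc, h⟩ := Slade2017_prop331_estimate hd hα0 hα2 hαd (p' := 2 * α) (by linarith)
  refine ⟨c * (6 * (1 + mbar)), by positivity, fun L hL m2 hm2 hm2' j hj x => ?_⟩
  have hL0 : (0 : ℝ) < L := by linarith
  set ℓ : ℝ := L ^ (j - 1) with hℓ
  have hℓ1 : 1 ≤ ℓ := one_le_pow₀ (by linarith)
  have hℓ0 : 0 < ℓ := by linarith
  set A : ℝ := m2 * ℓ ^ α with hA
  have hA0 : 0 ≤ A := mul_nonneg hm2 (Real.rpow_nonneg hℓ0.le _)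
  have hM : massFactor L α m2 j = ((1 + A) ^ 2)⁻¹ := by
    rw [massFactor_eq hL0.le α m2 hj]
  have h2α : ℓ ^ (2 * α) = (ℓ ^ α) ^ 2 := by
    rw [mul_comm, Real.rpow_mul hℓ0.le, Real.rpow_two]
  have hfirst : 1 / (1 + m2 ^ 2 * ℓ ^ (2 * α)) ≤ 2 * ((1 + A) ^ 2)⁻¹ := by
    have : m2 ^ 2 * ℓ ^ (2 * α) = A ^ 2 := by rw [h2α, hA]; ring
    rw [this]
    exact one_div_one_add_sq_le hA0
  have hsecond : 1 / (1 + m2 * ℓ ^ (2 * α)) ≤ 2 * (1 + mbar) * (2 * ((1 + A) ^ 2)⁻¹) :=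
    (second_term_le hℓ1 hα0.le hm2 hm2').trans
      (mul_le_mul_of_nonneg_left hfirst (by positivity))
  have hpre : 0 ≤ c * ℓ ^ (α - d) := mul_nonneg hc.le (Real.rpow_nonneg hℓ0.le _)
  calc |fracCov d L α m2 j x|
      ≤ c * ℓ ^ (α - d) * (1 / (1 + m2 ^ 2 * ℓ ^ (2 * α)) + 1 / (1 + m2 * ℓ ^ (2 * α))) :=
        h L hL m2 hm2 j hj x
    _ ≤ c * ℓ ^ (α - d) * (2 * ((1 + A) ^ 2)⁻¹ + 2 * (1 + mbar) * (2 * ((1 + A) ^ 2)⁻¹)) := by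
        gcongr
    _ ≤ c * ℓ ^ (α - d) * (6 * (1 + mbar) * ((1 + A) ^ 2)⁻¹) := by
        apply mul_le_mul_of_nonneg_left _ hpre
        have : 0 ≤ ((1 + A) ^ 2)⁻¹ := by positivity
        nlinarith
    _ = c * (6 * (1 + mbar)) * ℓ ^ (α - d) * massFactor L α m2 j := by rw [hM]; ring

/-! ### The mass scale: `j ∧ j_m` -/

/-- `j ∧ j_m`: the minimum of the scale `j` and the mass scale `j_m = ⌈f_m⌉` of §3.4
(`LongRangePhi4.massScale`) for `m² > 0`; for `m² = 0` (where `j_m = ∞`) it is `j`.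
[cite: Slade2017, §3.4 (the mass scale) and §5.2 (display (5.18): the exponents `j ∧ j_m`)] -/
def scaleMin (L α m2 : ℝ) (j : ℕ) : ℕ := if 0 < m2 then min j (massScale L α m2) else j

/-- `j ∧ j_m ≤ j`. [cite: Slade2017, §5.2 (display (5.18))] -/
theorem scaleMin_le (L α m2 : ℝ) (j : ℕ) : scaleMin L α m2 j ≤ j := by
  unfold scaleMin; split_ifs
  · exact min_le_left _ _
  · exact le_rfl

/-- For `m² ≤ 0` (so for the massless case), `j ∧ j_m = j`. [cite: Slade2017, §5.2 (display (5.18))] -/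
theorem scaleMin_of_not_pos {L α m2 : ℝ} (h : ¬0 < m2) (j : ℕ) : scaleMin L α m2 j = j := by
  simp [scaleMin, h]

/-- For `m² > 0`, `j ∧ j_m = min(j, j_m)`. [cite: Slade2017, §5.2 (display (5.18))] -/
theorem scaleMin_of_pos {L α m2 : ℝ} (h : 0 < m2) (j : ℕ) :
    scaleMin L α m2 j = min j (massScale L α m2) := by
  simp [scaleMin, h]

/-- `(j+1) ∧ j_m ≤ (j ∧ j_m) + 1`. [cite: Slade2017, §5.2 (display (5.18))] -/
theorem scaleMin_succ_le (L α m2 : ℝ) (j : ℕ) : scaleMin L α m2 (j + 1) ≤ scaleMin L α m2 j + 1 := by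
  unfold scaleMin; split_ifs <;> omega

/-- `j ∧ j_m` is monotone in `j`. [cite: Slade2017, §5.2 (display (5.18))] -/
theorem scaleMin_mono (L α m2 : ℝ) {j k : ℕ} (hjk : j ≤ k) : scaleMin L α m2 j ≤ scaleMin L α m2 k := by
  unfold scaleMin; split_ifs <;> omega

/-- `j ∧ j_m = j` when `j ≤ j_m`. [cite: Slade2017, §5.2 (display (5.18))] -/
theorem scaleMin_eq_self {L α m2 : ℝ} {j : ℕ} (h : 0 < m2 → j ≤ massScale L α m2) :
    scaleMin L α m2 j = j := by
  unfold scaleMin; split_ifs with hm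
  · exact min_eq_left (h hm)
  · rfl

/-- **The defining property of the mass scale:** `m²L^{α(j_m-1)} ≥ 1` ("the smallest scale `j_m`
for which `m²L^{α(j_m-1)} ≥ 1`, namely `j_m = ⌈f_m⌉`"), for every `m² > 0`, `L > 1`, `α > 0`.
[cite: Slade2017, §3.4 (the mass scale)] -/
theorem one_le_mass_mul_rpow_massScale {L α m2 : ℝ} (hL : 1 < L) (hα : 0 < α) (hm : 0 < m2) :
    1 ≤ m2 * L ^ (α * ((massScale L α m2 : ℝ) - 1)) := by
  have h : massScaleReal L α m2 ≤ (massScale L α m2 : ℝ) := massScale_ge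
  unfold massScaleReal at h
  have hL0 : 0 < L := by linarith
  have hlogL : 0 < Real.log L := Real.log_pos hL
  have h1 : Real.log m2⁻¹ / (α * Real.log L) ≤ (massScale L α m2 : ℝ) - 1 := by linarith
  rw [div_le_iff₀ (mul_pos hα hlogL)] at h1
  have h2 : m2⁻¹ ≤ L ^ (α * ((massScale L α m2 : ℝ) - 1)) := by
    rw [← Real.log_le_log_iff (inv_pos.mpr hm) (Real.rpow_pos_of_pos hL0 _), Real.log_rpow hL0]
    linarith
  calc (1 : ℝ) = m2 * m2⁻¹ := (mul_inv_cancel₀ hm.ne').symm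
    _ ≤ m2 * L ^ (α * ((massScale L α m2 : ℝ) - 1)) := mul_le_mul_of_nonneg_left h2 hm.le

/-- **(5.21): `M_k ≤ L^{-2α(k-j_m)}` beyond the mass scale** (`k ≥ j_m`, `m² > 0`).
[cite: Slade2017, §5.2 (display (5.21)) and §3.4 (display after the mass scale)] -/
theorem massFactor_le_of_massScale_le {L α m2 : ℝ} (hL : 1 < L) (hα : 0 < α) (hm : 0 < m2)
    {k : ℕ} (hk : massScale L α m2 ≤ k) :
    massFactor L α m2 k ≤ (((L ^ α) ^ (k - massScale L α m2)) ^ 2)⁻¹ := by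
  have hL0 : 0 < L := by linarith
  unfold massFactor
  have e : L ^ (α * ((k : ℝ) - 1)) =
      L ^ (α * ((massScale L α m2 : ℝ) - 1)) * (L ^ α) ^ (k - massScale L α m2) := by
    rw [← Real.rpow_natCast (L ^ α) (k - massScale L α m2), ← Real.rpow_mul hL0.le,
      ← Real.rpow_add hL0]
    congr 1
    push_cast [Nat.cast_sub hk]
    ring
  have hP0 : 0 < (L ^ α) ^ (k - massScale L α m2) := by positivity
  have hP : (L ^ α) ^ (k - massScale L α m2) ≤ 1 + m2 * L ^ (α * ((k : ℝ) - 1)) := by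
    rw [e, ← mul_assoc]
    have h1 := one_le_mass_mul_rpow_massScale hL hα hm
    nlinarith
  apply inv_anti₀ (by positivity)
  exact pow_le_pow_left₀ hP0.le hP 2

/-- A geometric sum with ratio `ρ > 1` is dominated by its last term: `Σ_{k≤J} ρ^k ≤ ρ^J ρ/(ρ-1)`.
[folklore] -/
theorem geom_sum_range_le {ρ : ℝ} (hρ : 1 < ρ) (J : ℕ) :
    ∑ k ∈ Finset.range (J + 1), ρ ^ k ≤ ρ ^ J * (ρ / (ρ - 1)) := by
  rw [geom_sum_eq hρ.ne' (J + 1)]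
  have h : 0 < ρ - 1 := by linarith
  rw [div_le_iff₀ h, mul_assoc, div_mul_cancel₀ _ h.ne', ← pow_succ]
  linarith

/-- **"`Σ_{k=1}^j L^{dk}M_kL^{-(d-α)k} ≲ L^{α(j∧j_m)}`"** (the scale sum in the bound on `w_j^{(1)}`
in the proof of Lemma 5.2.1), in the form `Σ_{k=0}^{j} (L^α)^k M_k ≤ 2K_α (L^α)^{j∧j_m}`,
`K_α = 2^α/(2^α-1)`, for `L ≥ 2`, `m² ≥ 0`: below the mass scale `M_k ≤ 1` and the geometric sum
is dominated by its last term; beyond it (5.21) `M_k ≤ L^{-2α(k-j_m)}` makes the terms decay.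
[cite: Slade2017, §10.2 (proof of Lemma 5.2.1, bound on `w_j^{(1)}`)] -/
theorem sum_pow_mul_massFactor_le {L : ℝ} (hL : 2 ≤ L) {α : ℝ} (hα : 0 < α) {m2 : ℝ}
    (hm2 : 0 ≤ m2) (j : ℕ) :
    ∑ k ∈ Finset.range (j + 1), (L ^ α) ^ k * massFactor L α m2 k ≤
      2 * ((2 : ℝ) ^ α / ((2 : ℝ) ^ α - 1)) * (L ^ α) ^ scaleMin L α m2 j := by
  have hL0 : (0 : ℝ) < L := by linarith
  have hL1 : (1 : ℝ) < L := by linarith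
  set ρ : ℝ := L ^ α with hρ
  have h2α : (1 : ℝ) < (2 : ℝ) ^ α := Real.one_lt_rpow (by norm_num) hα
  have hρ2 : (2 : ℝ) ^ α ≤ ρ := Real.rpow_le_rpow (by norm_num) hL hα.le
  have hρ1 : 1 < ρ := lt_of_lt_of_le h2α hρ2
  have hρ0 : 0 < ρ := by linarith
  set K : ℝ := (2 : ℝ) ^ α / ((2 : ℝ) ^ α - 1) with hK
  have hK1 : ρ / (ρ - 1) ≤ K := by
    rw [hK, div_le_div_iff₀ (by linarith) (by linarith)]
    nlinarith
  have hK0 : 1 ≤ K := by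
    rw [hK, le_div_iff₀ (by linarith)]
    linarith
  have hM1 : ∀ k, massFactor L α m2 k ≤ 1 := fun k => massFactor_le_one hL0 α hm2 k
  have hM0 : ∀ k, 0 ≤ massFactor L α m2 k := fun k => (massFactor_pos hL0 α hm2 k).le
  have hA : ∀ J : ℕ, ∑ k ∈ Finset.range (J + 1), ρ ^ k * massFactor L α m2 k ≤ K * ρ ^ J := by
    intro J
    calc ∑ k ∈ Finset.range (J + 1), ρ ^ k * massFactor L α m2 k
        ≤ ∑ k ∈ Finset.range (J + 1), ρ ^ k := Finset.sum_le_sum fun k _ => by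
            have h1 := hM1 k
            have h0 : 0 ≤ ρ ^ k := by positivity
            nlinarith
      _ ≤ ρ ^ J * (ρ / (ρ - 1)) := geom_sum_range_le hρ1 J
      _ ≤ ρ ^ J * K := by gcongr
      _ = K * ρ ^ J := mul_comm _ _
  by_cases hcase : 0 < m2 ∧ massScale L α m2 < j
  · obtain ⟨hm, hjm⟩ := hcase
    have hsm : scaleMin L α m2 j = massScale L α m2 := by
      rw [scaleMin_of_pos hm, min_eq_right hjm.le]
    rw [hsm]
    set jm := massScale L α m2 with hjmdef
    rw [Finset.range_eq_Ico, ← Finset.sum_Ico_consecutive _ (Nat.zero_le (jm + 1))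
      (by omega : jm + 1 ≤ j + 1), ← Finset.range_eq_Ico]
    have hr0 : 0 ≤ ρ⁻¹ := by positivity
    have hr1 : ρ⁻¹ < 1 := inv_lt_one_of_one_lt₀ hρ1
    have htail : ∑ k ∈ Finset.Ico (jm + 1) (j + 1), ρ ^ k * massFactor L α m2 k ≤ K * ρ ^ jm := by
      have hterm : ∀ k ∈ Finset.Ico (jm + 1) (j + 1),
          ρ ^ k * massFactor L α m2 k ≤ ρ ^ jm * (ρ⁻¹) ^ (k - jm) := by
        intro k hk
        rw [Finset.mem_Ico] at hk
        have hk' : jm ≤ k := by omega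
        have hMk := massFactor_le_of_massScale_le hL1 hα hm hk'
        calc ρ ^ k * massFactor L α m2 k ≤ ρ ^ k * (((ρ ^ (k - jm)) ^ 2)⁻¹) := by gcongr
          _ = ρ ^ jm * (ρ⁻¹) ^ (k - jm) := by
              have e : ρ ^ k = ρ ^ jm * ρ ^ (k - jm) := by rw [← pow_add]; congr 1; omega
              rw [e, inv_pow]
              field_simp
      calc ∑ k ∈ Finset.Ico (jm + 1) (j + 1), ρ ^ k * massFactor L α m2 k
          ≤ ∑ k ∈ Finset.Ico (jm + 1) (j + 1), ρ ^ jm * (ρ⁻¹) ^ (k - jm) :=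
            Finset.sum_le_sum hterm
        _ = ρ ^ jm * (ρ⁻¹ * ∑ i ∈ Finset.range (j - jm), (ρ⁻¹) ^ i) := by
            rw [Finset.sum_Ico_eq_sum_range, Finset.mul_sum, Finset.mul_sum]
            have e : j + 1 - (jm + 1) = j - jm := by omega
            rw [e]
            refine Finset.sum_congr rfl fun i _ => ?_
            have e' : jm + 1 + i - jm = i + 1 := by omega
            rw [e', pow_succ]
            ring
        _ ≤ ρ ^ jm * (ρ⁻¹ * (1 - ρ⁻¹)⁻¹) := by
            gcongr
            exact ((summable_geometric_of_lt_one hr0 hr1).sum_le_tsum _ (fun i _ => by positivity)).trans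
              (tsum_geometric_of_lt_one hr0 hr1).le
        _ = ρ ^ jm * (1 / (ρ - 1)) := by
            congr 1
            field_simp
        _ ≤ ρ ^ jm * K := by
            gcongr
            calc 1 / (ρ - 1) ≤ ρ / (ρ - 1) := div_le_div_of_nonneg_right hρ1.le (by linarith)
              _ ≤ K := hK1
        _ = K * ρ ^ jm := mul_comm _ _
    calc ∑ k ∈ Finset.range (jm + 1), ρ ^ k * massFactor L α m2 k
          + ∑ k ∈ Finset.Ico (jm + 1) (j + 1), ρ ^ k * massFactor L α m2 k
        ≤ K * ρ ^ jm + K * ρ ^ jm := add_le_add (hA jm) htail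
      _ = 2 * K * ρ ^ jm := by ring
  · have hsm : scaleMin L α m2 j = j :=
      scaleMin_eq_self fun hm => not_lt.mp fun h' => hcase ⟨hm, h'⟩
    rw [hsm]
    calc ∑ k ∈ Finset.range (j + 1), ρ ^ k * massFactor L α m2 k ≤ K * ρ ^ j := hA j
      _ ≤ 2 * K * ρ ^ j := by nlinarith [pow_pos hρ0 j]

/-! ### Finite support: sums over `ℤ^d` -/

/-- The box of sites with every coordinate an integer in `[-R,R]`. [folklore] -/
def box (R : ℝ) : Finset (Site d) := Fintype.piFinset fun _ : Fin d => Finset.Icc ⌈-R⌉ ⌊R⌋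

/-- A site with `|x|₁ < R` lies in the box. [folklore] -/
theorem mem_box_of_lt {R : ℝ} {x : Site d} (hx : (((∑ i, (x i).natAbs : ℕ) : ℝ)) < R) :
    x ∈ box R := by
  rw [box, Fintype.mem_piFinset]
  intro i
  have h1 : (((x i).natAbs : ℕ) : ℝ) < R := by
    refine lt_of_le_of_lt ?_ hx
    exact_mod_cast Finset.single_le_sum (f := fun k => (x k).natAbs) (fun k _ => Nat.zero_le _)
      (Finset.mem_univ i)
  rw [← Int.cast_natCast, Int.natCast_natAbs, Int.cast_abs, abs_lt] at h1
  rw [Finset.mem_Icc]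
  constructor
  · rw [Int.ceil_le]
    linarith [h1.1]
  · rw [Int.le_floor]
    linarith [h1.2]

/-- The finite set of sites `x ∈ ℤ^d` with `|x|₁ < R`. [folklore] -/
def ball (R : ℝ) : Finset (Site d) := (box R).filter fun x => (((∑ i, (x i).natAbs : ℕ) : ℝ)) < R

/-- Membership in `ball R` is `|x|₁ < R`. [folklore] -/
theorem mem_ball {R : ℝ} {x : Site d} : x ∈ ball R ↔ (((∑ i, (x i).natAbs : ℕ) : ℝ)) < R := by
  rw [ball, Finset.mem_filter]
  exact ⟨fun h => h.2, fun h => ⟨mem_box_of_lt h, h⟩⟩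

/-- `#{x ∈ ℤ^d : |x|₁ < R} ≤ (2R+1)^d` (each coordinate is an integer in `[-R,R]`). [folklore] -/
theorem card_ball_le {R : ℝ} (hR : 0 ≤ R) : ((ball (d := d) R).card : ℝ) ≤ (2 * R + 1) ^ d := by
  classical
  set lo : ℤ := ⌈-R⌉ with hlo
  set hi : ℤ := ⌊R⌋ with hhi
  have hsub : ball (d := d) R ⊆ box R := Finset.filter_subset _ _
  have hcnt : ((Finset.Icc lo hi).card : ℝ) ≤ 2 * R + 1 := by
    rw [Int.card_Icc]
    have h1 : (hi : ℝ) ≤ R := Int.floor_le R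
    have h2 : (-R : ℝ) ≤ lo := Int.le_ceil (-R)
    rcases le_or_gt 0 (hi + 1 - lo) with h | h
    · have e : (((hi + 1 - lo).toNat : ℕ) : ℤ) = hi + 1 - lo := Int.toNat_of_nonneg h
      have e' : (((hi + 1 - lo).toNat : ℕ) : ℝ) = (hi : ℝ) + 1 - lo := by
        have := congrArg (fun z : ℤ => (z : ℝ)) e
        push_cast at this
        exact this
      rw [e']
      linarith
    · rw [Int.toNat_eq_zero.mpr h.le]
      push_cast
      linarith
  have hcard : (((box (d := d) R).card : ℕ) : ℝ) = ((Finset.Icc lo hi).card : ℝ) ^ d := by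
    rw [box, Fintype.card_piFinset, Finset.prod_const, Finset.card_univ, Fintype.card_fin]
    push_cast
    rfl
  calc ((ball (d := d) R).card : ℝ) ≤ (box (d := d) R).card := by
        exact_mod_cast Finset.card_le_card hsub
    _ = ((Finset.Icc lo hi).card : ℝ) ^ d := hcard
    _ ≤ (2 * R + 1) ^ d := pow_le_pow_left₀ (Nat.cast_nonneg _) hcnt d

/-- `C_{i;0,x} = 0` off the ball `|x|₁ < ½L^j`, for all `i ≤ j` (`L ≥ 1`): finite range.
[cite: Slade2017, Proposition 3.3.1 (finite range ½L^j)] -/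
theorem fracCov_eq_zero_of_not_mem_ball (hd : 1 ≤ d) {L : ℝ} (hL : 1 ≤ L) (α m2 : ℝ) {i j : ℕ}
    (hij : i ≤ j) {x : Site d} (hx : x ∉ ball (L ^ j / 2)) : fracCov d L α m2 i x = 0 := by
  rw [mem_ball, not_lt] at hx
  exact fracCov_eq_zero_of_le hd (by linarith) α m2 i x
    ((div_le_div_of_nonneg_right (pow_le_pow_right₀ hL hij) (by norm_num)).trans hx)

/-- **`Σ_x |C_{k;0,x}| ≤ c L^d (L^α)^k M_k`** ("`|w_j^{(1)}| ≤ Σ_xΣ_k|C_{k;0,x}| ≲ Σ_k L^{dk}M_kL^{-(d-α)k}`":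
the number of sites in the range times the uniform bound (3.9)), for every finite set of sites,
`L ≥ 2`, `m² ∈ [0,m̄²]`, `k ≥ 1`; `c` depends on `d, α, m̄²` only.
[cite: Slade2017, §10.2 (proof of Lemma 5.2.1, bound on `w_j^{(1)}`)] -/
theorem sum_abs_fracCov_le (hd : 1 ≤ d) {α : ℝ} (hα0 : 0 < α) (hα2 : α < 2) (hαd : α < d)
    {mbar : ℝ} (hmbar : 0 ≤ mbar) :
    ∃ c : ℝ, 0 < c ∧ ∀ L : ℝ, 2 ≤ L → ∀ m2 : ℝ, 0 ≤ m2 → m2 ≤ mbar → ∀ k : ℕ, 1 ≤ k →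
      ∀ S : Finset (Site d), ∑ x ∈ S, |fracCov d L α m2 k x| ≤
        c * L ^ d * (L ^ α) ^ k * massFactor L α m2 k := by
  classical
  obtain ⟨c, hc, h⟩ := abs_fracCov_le_massFactor hd hα0 hα2 hαd hmbar
  refine ⟨2 ^ d * c, by positivity, fun L hL m2 hm2 hm2' k hk S => ?_⟩
  have hL0 : (0 : ℝ) < L := by linarith
  have hL1 : (1 : ℝ) ≤ L := by linarith
  set ℓ : ℝ := L ^ (k - 1) with hℓ
  have hℓ0 : 0 < ℓ := by positivity
  have hM0 : 0 ≤ massFactor L α m2 k := (massFactor_pos hL0 α hm2 k).le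
  -- restrict to the support
  have hrestr : ∑ x ∈ S, |fracCov d L α m2 k x| = ∑ x ∈ S ∩ ball (L ^ k / 2), |fracCov d L α m2 k x| := by
    rw [← Finset.sum_sdiff (Finset.inter_subset_left (s₁ := S) (s₂ := ball (L ^ k / 2)))]
    rw [Finset.sum_eq_zero (s := S \ (S ∩ ball (L ^ k / 2))) fun x hx => by
      rw [Finset.mem_sdiff, Finset.mem_inter, not_and] at hx
      rw [fracCov_eq_zero_of_not_mem_ball hd hL1 α m2 le_rfl (hx.2 hx.1), abs_zero], zero_add]
  have hcard : (((S ∩ ball (L ^ k / 2)).card : ℕ) : ℝ) ≤ (L ^ k + 1) ^ d := by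
    calc (((S ∩ ball (L ^ k / 2)).card : ℕ) : ℝ) ≤ (ball (d := d) (L ^ k / 2)).card := by
          exact_mod_cast Finset.card_le_card Finset.inter_subset_right
      _ ≤ (2 * (L ^ k / 2) + 1) ^ d := card_ball_le (by positivity)
      _ = (L ^ k + 1) ^ d := by ring
  have hsup : ∀ x, |fracCov d L α m2 k x| ≤ c * ℓ ^ (α - d) * massFactor L α m2 k :=
    fun x => h L hL m2 hm2 hm2' k hk x
  -- (L^k+1)^d ℓ^{α-d} ≤ 2^d L^d (L^α)^k
  have hpow : (L ^ k + 1) ^ d * ℓ ^ (α - (d : ℝ)) ≤ 2 ^ d * L ^ d * (L ^ α) ^ k := by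
    have h1 : (L ^ k + 1) ^ d ≤ (2 * L ^ k) ^ d := by
      apply pow_le_pow_left₀ (by positivity)
      have : (1 : ℝ) ≤ L ^ k := one_le_pow₀ hL1
      linarith
    have h2 : (2 * L ^ k) ^ d = 2 ^ d * L ^ d * ℓ ^ (d : ℝ) := by
      rw [Real.rpow_natCast, mul_pow, hℓ, ← pow_mul, ← pow_mul]
      have e : L ^ d * L ^ ((k - 1) * d) = L ^ (k * d) := by
        rw [← pow_add]; congr 1
        have : 1 ≤ k := hk
        calc d + (k - 1) * d = (1 + (k - 1)) * d := by ring
          _ = k * d := by rw [Nat.add_sub_cancel' this]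
      rw [mul_assoc, e]
    have h3 : ℓ ^ (d : ℝ) * ℓ ^ (α - (d : ℝ)) = (L ^ α) ^ (k - 1) := by
      rw [← Real.rpow_add hℓ0, add_sub_cancel, hℓ, ← Real.rpow_natCast L (k - 1),
        ← Real.rpow_mul hL0.le, mul_comm, Real.rpow_mul hL0.le, Real.rpow_natCast]
    have h4 : (L ^ α) ^ (k - 1) ≤ (L ^ α) ^ k :=
      pow_le_pow_right₀ (Real.one_le_rpow hL1 hα0.le) (Nat.sub_le k 1)
    have hnn : 0 ≤ ℓ ^ (α - (d : ℝ)) := Real.rpow_nonneg hℓ0.le _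
    calc (L ^ k + 1) ^ d * ℓ ^ (α - (d : ℝ)) ≤ (2 * L ^ k) ^ d * ℓ ^ (α - (d : ℝ)) :=
          mul_le_mul_of_nonneg_right h1 hnn
      _ = 2 ^ d * L ^ d * (ℓ ^ (d : ℝ) * ℓ ^ (α - (d : ℝ))) := by rw [h2]; ring
      _ = 2 ^ d * L ^ d * (L ^ α) ^ (k - 1) := by rw [h3]
      _ ≤ 2 ^ d * L ^ d * (L ^ α) ^ k := by gcongr
  calc ∑ x ∈ S, |fracCov d L α m2 k x|
      = ∑ x ∈ S ∩ ball (L ^ k / 2), |fracCov d L α m2 k x| := hrestr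
    _ ≤ ∑ _x ∈ S ∩ ball (L ^ k / 2), c * ℓ ^ (α - d) * massFactor L α m2 k :=
        Finset.sum_le_sum fun x _ => hsup x
    _ = ((S ∩ ball (L ^ k / 2)).card : ℝ) * (c * ℓ ^ (α - d) * massFactor L α m2 k) := by
        rw [Finset.sum_const, nsmul_eq_mul]
    _ ≤ (L ^ k + 1) ^ d * (c * ℓ ^ (α - d) * massFactor L α m2 k) := by
        apply mul_le_mul_of_nonneg_right hcard
        exact mul_nonneg (mul_nonneg hc.le (Real.rpow_nonneg hℓ0.le _)) hM0
    _ = c * ((L ^ k + 1) ^ d * ℓ ^ (α - (d : ℝ))) * massFactor L α m2 k := by ring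
    _ ≤ c * (2 ^ d * L ^ d * (L ^ α) ^ k) * massFactor L α m2 k := by gcongr
    _ = 2 ^ d * c * L ^ d * (L ^ α) ^ k * massFactor L α m2 k := by ring

/-! ### The coefficients of §5.1–§5.2 for the decomposition `(C_j)` of `ℤ^d` -/

/-- **`w_j = Σ_{i=1}^{j} C_i`, `w_0 = 0`** (§4.3: "With `C_j` given by (3.8), let `w_j = Σ_{i=1}^j C_i`
and `w_0 = 0`"), as a function `x ↦ w_{j;0,x}` on `ℤ^d` ("Throughout Section 5, the covariance
decomposition is for `ℤ^d` rather than for the torus"). [cite: Slade2017, §4.3 and §5.1] -/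
def wCov (d : ℕ) (L α m2 : ℝ) (j : ℕ) (x : Site d) : ℝ := ∑ i ∈ Finset.Icc 1 j, fracCov d L α m2 i x

/-- **`q^{(n)} = Σ_{x} q_x^n`** for `q : ℤ^d → ℝ` of finite support ((5.3)); as a `tsum` (a finite
sum for finitely supported `q` and `n ≥ 1`). [cite: Slade2017, §5.1 (display (5.3))] -/
def powSum {d : ℕ} (q : Site d → ℝ) (p : ℕ) : ℝ := ∑' x, q x ^ p

/-- **`η'_j = (n+2) C_{j+1;0,0}`** ((5.1): "`C = C_{j+1;0,0}`, … , `η' = (n+2)C`").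
[cite: Slade2017, §5.1 (display (5.1))] -/
def etaPrime (d n : ℕ) (L α m2 : ℝ) (j : ℕ) : ℝ := (n + 2) * fracCov d L α m2 (j + 1) 0

/-- **`η_j = L^{(d-α)j} η'_j`** ((5.18)). [cite: Slade2017, §5.2 (display (5.18))] -/
def etaCoeff (d n : ℕ) (L α m2 : ℝ) (j : ℕ) : ℝ := (L ^ ((d : ℝ) - α)) ^ j * etaPrime d n L α m2 j

/-- **`η_{≥j} = Σ_{k=j}^∞ L^{-(d-α)(k-j)} η_k`** (`= L^{(d-α)j} η'_{≥j}`, `η'_{≥j} = Σ_{k≥j} η'_k`; (5.20)),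
written as `Σ_{k≥0} L^{-(d-α)k} η_{j+k}`. [cite: Slade2017, §5.2 (display (5.20))] -/
def etaGe (d n : ℕ) (L α m2 : ℝ) (j : ℕ) : ℝ :=
  ∑' k : ℕ, ((L ^ ((d : ℝ) - α)) ^ k)⁻¹ * etaCoeff d n L α m2 (j + k)

/-- **`w_j^{(1)} = Σ_x w_{j;0,x}`** ((5.3) with `q = w_j`, `n = 1`). [cite: Slade2017, §5.1–§5.2] -/
def wOne (d : ℕ) (L α m2 : ℝ) (j : ℕ) : ℝ := powSum (wCov d L α m2 j) 1

/-- **`w̄_j^{(1)} = L^{-α(j∧j_m)} w_j^{(1)}`** ((5.18)). [cite: Slade2017, §5.2 (display (5.18))] -/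
def wbarOne (d : ℕ) (L α m2 : ℝ) (j : ℕ) : ℝ := ((L ^ α) ^ scaleMin L α m2 j)⁻¹ * wOne d L α m2 j

/-- **`β'_j = (n+8) δ[w^{(2)}] = (n+8)(w_{j+1}^{(2)} - w_j^{(2)})`** ((5.5), with (5.2):
`δ[f(ν,w)] = f(ν⁺,w₊) - f(ν,w)`, `w₊ = w_j + C_{j+1} = w_{j+1}`). [cite: Slade2017, §5.1 (display (5.5))] -/
def betaPrime (d n : ℕ) (L α m2 : ℝ) (j : ℕ) : ℝ :=
  (n + 8) * (powSum (wCov d L α m2 (j + 1)) 2 - powSum (wCov d L α m2 j) 2)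

/-- **`β_j = L^{-ε(j∧j_m)} β'_j`**, `ε = 2α - d` ((5.18)). [cite: Slade2017, §5.2 (display (5.18))] -/
def betaCoeff (d n : ℕ) (L α m2 : ℝ) (j : ℕ) : ℝ :=
  ((L ^ (2 * α - d)) ^ scaleMin L α m2 j)⁻¹ * betaPrime d n L α m2 j

/-- **`β^:_j = β_j + 4(η_{≥j} w̄_j^{(1)} - η_{≥j+1} w̄_{j+1}^{(1)})`** ((5.21); the abstract formula is
`LongRangePhi4.betaW` of the change of variables of §5.3). [cite: Slade2017, §5.2 (display defining `β^:_j`)] -/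
def betaWCoeff (d n : ℕ) (L α m2 : ℝ) (j : ℕ) : ℝ :=
  betaW (betaCoeff d n L α m2 j) (etaGe d n L α m2 j) (wbarOne d L α m2 j)
    (etaGe d n L α m2 (j + 1)) (wbarOne d L α m2 (j + 1))

/-! ### Elementary properties -/

/-- `q^{(p)}` is a finite sum over any finite set containing the support of `q` (`p ≥ 1`).
[cite: Slade2017, §5.1 (display (5.3))] -/
theorem powSum_eq_sum {q : Site d → ℝ} {S : Finset (Site d)} (hq : ∀ x ∉ S, q x = 0) {p : ℕ}
    (hp : p ≠ 0) : powSum q p = ∑ x ∈ S, q x ^ p := by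
  unfold powSum
  exact tsum_eq_sum fun x hx => by rw [hq x hx, zero_pow hp]

/-- `w_0 = 0`. [cite: Slade2017, §4.3] -/
theorem wCov_zero (d : ℕ) (L α m2 : ℝ) (x : Site d) : wCov d L α m2 0 x = 0 := by
  simp [wCov]

/-- `w_{j+1} = w_j + C_{j+1}` ("`w₊ = w + C_{j+1}`"). [cite: Slade2017, §5.1 (display (5.1))] -/
theorem wCov_succ (d : ℕ) (L α m2 : ℝ) (j : ℕ) (x : Site d) :
    wCov d L α m2 (j + 1) x = wCov d L α m2 j x + fracCov d L α m2 (j + 1) x := by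
  unfold wCov
  rw [Finset.sum_Icc_succ_top (by omega)]

/-- "The range of `w_j` is that of `C_j`, namely `½L^j`": `w_{i;0,x} = 0` off `|x|₁ < ½L^j`, `i ≤ j`.
[cite: Slade2017, §4.3] -/
theorem wCov_eq_zero_of_not_mem_ball (hd : 1 ≤ d) {L : ℝ} (hL : 1 ≤ L) (α m2 : ℝ) {i j : ℕ}
    (hij : i ≤ j) {x : Site d} (hx : x ∉ ball (L ^ j / 2)) : wCov d L α m2 i x = 0 :=
  Finset.sum_eq_zero fun _ hk =>
    fracCov_eq_zero_of_not_mem_ball hd hL α m2 ((Finset.mem_Icc.mp hk).2.trans hij) hx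

/-- `Σ_{x∈S} |w_{j;0,x}| ≤ c L^d · 2K_α (L^α)^{j∧j_m}` for every finite `S`: the `ℓ¹` norm of `w_j`
("`Σ_xΣ_{k=1}^j |C_{k;0,x}| ≲ Σ_{k=1}^j L^{dk}M_kL^{-(d-α)k} ≲ L^{α(j∧j_m)}`").
[cite: Slade2017, §10.2 (proof of Lemma 5.2.1, bound on `w_j^{(1)}`)] -/
theorem sum_abs_wCov_le (hd : 1 ≤ d) {α : ℝ} (hα0 : 0 < α) (hα2 : α < 2) (hαd : α < d)
    {mbar : ℝ} (hmbar : 0 ≤ mbar) :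
    ∃ c : ℝ, 0 < c ∧ ∀ L : ℝ, 2 ≤ L → ∀ m2 : ℝ, 0 ≤ m2 → m2 ≤ mbar → ∀ j : ℕ,
      ∀ S : Finset (Site d), ∑ x ∈ S, |wCov d L α m2 j x| ≤
        c * L ^ d * (L ^ α) ^ scaleMin L α m2 j := by
  obtain ⟨c, hc, h⟩ := sum_abs_fracCov_le hd hα0 hα2 hαd hmbar
  have h2α : (1 : ℝ) < (2 : ℝ) ^ α := Real.one_lt_rpow (by norm_num) hα0
  refine ⟨c * (2 * ((2 : ℝ) ^ α / ((2 : ℝ) ^ α - 1))), by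
    have : 0 < (2 : ℝ) ^ α / ((2 : ℝ) ^ α - 1) := div_pos (by linarith) (by linarith)
    positivity, fun L hL m2 hm2 hm2' j S => ?_⟩
  have hL0 : (0 : ℝ) < L := by linarith
  calc ∑ x ∈ S, |wCov d L α m2 j x|
      ≤ ∑ x ∈ S, ∑ i ∈ Finset.Icc 1 j, |fracCov d L α m2 i x| :=
        Finset.sum_le_sum fun x _ => Finset.abs_sum_le_sum_abs _ _
    _ = ∑ i ∈ Finset.Icc 1 j, ∑ x ∈ S, |fracCov d L α m2 i x| := Finset.sum_comm
    _ ≤ ∑ i ∈ Finset.Icc 1 j, c * L ^ d * (L ^ α) ^ i * massFactor L α m2 i :=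
        Finset.sum_le_sum fun i hi => h L hL m2 hm2 hm2' i (Finset.mem_Icc.mp hi).1 S
    _ ≤ ∑ i ∈ Finset.range (j + 1), c * L ^ d * (L ^ α) ^ i * massFactor L α m2 i := by
        apply Finset.sum_le_sum_of_subset_of_nonneg
        · intro i hi
          rw [Finset.mem_Icc] at hi
          rw [Finset.mem_range]
          omega
        · intro i _ _
          have := (massFactor_pos hL0 α hm2 i).le
          positivity
    _ = c * L ^ d * ∑ i ∈ Finset.range (j + 1), (L ^ α) ^ i * massFactor L α m2 i := by
        rw [Finset.mul_sum]
        refine Finset.sum_congr rfl fun i _ => by ring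
    _ ≤ c * L ^ d * (2 * ((2 : ℝ) ^ α / ((2 : ℝ) ^ α - 1)) * (L ^ α) ^ scaleMin L α m2 j) := by
        gcongr
        exact sum_pow_mul_massFactor_le hL hα0 hm2 j
    _ = c * (2 * ((2 : ℝ) ^ α / ((2 : ℝ) ^ α - 1))) * L ^ d * (L ^ α) ^ scaleMin L α m2 j := by ring

/-! ### Lemma 5.2.1: the bounds on `η_j`, `η_{≥j}` -/

/-- **Lemma 5.2.1, `η_j = O(M_j)` with a constant independent of `L`:**
`|η_j| = (n+2)L^{(d-α)j}|C_{j+1;0,0}| ≤ c M_j` for all `L ≥ 2`, `m² ∈ [0,m̄²]`, `j ≥ 0`, with `c`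
depending on `d, n, α, m̄²` only ("It follows immediately from the definitions … together with
the bound (3.9) on the covariance, that `η_j = (n+2)L^{(d-α)j}C_{j+1;0,0} ≲ M_j`, with a constant that
is independent of `L`"). [cite: Slade2017, Lemma 5.2.1 (bound on `η_j`); §10.2 (display (10.26))] -/
theorem abs_etaCoeff_le (hd : 1 ≤ d) (n : ℕ) {α : ℝ} (hα0 : 0 < α) (hα2 : α < 2) (hαd : α < d)
    {mbar : ℝ} (hmbar : 0 ≤ mbar) :
    ∃ c : ℝ, 0 < c ∧ ∀ L : ℝ, 2 ≤ L → ∀ m2 : ℝ, 0 ≤ m2 → m2 ≤ mbar → ∀ j : ℕ,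
      |etaCoeff d n L α m2 j| ≤ c * massFactor L α m2 j := by
  obtain ⟨c, hc, h⟩ := abs_fracCov_le_massFactor hd hα0 hα2 hαd hmbar
  refine ⟨(n + 2) * c, by positivity, fun L hL m2 hm2 hm2' j => ?_⟩
  have hL0 : (0 : ℝ) < L := by linarith
  have hC := h L hL m2 hm2 hm2' (j + 1) (by omega) 0
  rw [Nat.add_sub_cancel] at hC
  have hscale : (L ^ ((d : ℝ) - α)) ^ j * (L ^ j) ^ (α - (d : ℝ)) = 1 := by
    rw [← Real.rpow_natCast (L ^ ((d : ℝ) - α)) j, ← Real.rpow_mul hL0.le, ← Real.rpow_natCast L j,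
      ← Real.rpow_mul hL0.le, ← Real.rpow_add hL0]
    have e : ((d : ℝ) - α) * j + j * (α - d) = 0 := by ring
    rw [e, Real.rpow_zero]
  have hpos : (0 : ℝ) ≤ (L ^ ((d : ℝ) - α)) ^ j := by positivity
  unfold etaCoeff etaPrime
  rw [abs_mul, abs_mul, abs_of_nonneg hpos, abs_of_nonneg (by positivity : (0 : ℝ) ≤ (n : ℝ) + 2)]
  calc (L ^ ((d : ℝ) - α)) ^ j * ((n + 2) * |fracCov d L α m2 (j + 1) 0|)
      ≤ (L ^ ((d : ℝ) - α)) ^ j * ((n + 2) * (c * (L ^ j) ^ (α - (d : ℝ)) * massFactor L α m2 (j + 1))) := by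
        gcongr
    _ = (n + 2) * c * ((L ^ ((d : ℝ) - α)) ^ j * (L ^ j) ^ (α - (d : ℝ))) *
          massFactor L α m2 (j + 1) := by ring
    _ = (n + 2) * c * massFactor L α m2 (j + 1) := by rw [hscale, mul_one]
    _ ≤ (n + 2) * c * massFactor L α m2 j := by
        gcongr
        exact massFactor_succ_le (by linarith) hα0.le hm2 j

/-- **Lemma 5.2.1, `η_{≥j} = O(M_j)` uniformly in `L ≥ 2`:** the series (5.20) converges absolutely
(`|L^{-(d-α)k}η_{j+k}| ≤ cM_j L^{-(d-α)k}`, a geometric series since `d > α`) and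
`|η_{≥j}| ≤ c K_{d-α} M_j`, `K_{d-α} = 2^{d-α}/(2^{d-α}-1)` ("The desired bound on `η_{≥j}` then follows as
well"). [cite: Slade2017, Lemma 5.2.1 (bound on `η_{≥j}`); §10.2] -/
theorem summable_etaGe_and_abs_le (hd : 1 ≤ d) (n : ℕ) {α : ℝ} (hα0 : 0 < α) (hα2 : α < 2)
    (hαd : α < d) {mbar : ℝ} (hmbar : 0 ≤ mbar) :
    ∃ c : ℝ, 0 < c ∧ ∀ L : ℝ, 2 ≤ L → ∀ m2 : ℝ, 0 ≤ m2 → m2 ≤ mbar → ∀ j : ℕ,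
      Summable (fun k : ℕ => ((L ^ ((d : ℝ) - α)) ^ k)⁻¹ * etaCoeff d n L α m2 (j + k)) ∧
      |etaGe d n L α m2 j| ≤ c * massFactor L α m2 j := by
  obtain ⟨c, hc, h⟩ := abs_etaCoeff_le hd n hα0 hα2 hαd hmbar
  have hdα : 0 < (d : ℝ) - α := by linarith
  set q : ℝ := (2 : ℝ) ^ ((d : ℝ) - α) with hq
  have hq1 : 1 < q := Real.one_lt_rpow (by norm_num) hdα
  set K : ℝ := q / (q - 1) with hK
  have hK0 : 0 < K := div_pos (by linarith) (by linarith)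
  refine ⟨c * K, by positivity, fun L hL m2 hm2 hm2' j => ?_⟩
  have hL0 : (0 : ℝ) < L := by linarith
  have hL1 : (1 : ℝ) ≤ L := by linarith
  set ρ : ℝ := L ^ ((d : ℝ) - α) with hρ
  have hρq : q ≤ ρ := Real.rpow_le_rpow (by norm_num) hL hdα.le
  have hρ1 : 1 < ρ := lt_of_lt_of_le hq1 hρq
  have hρ0 : 0 < ρ := by linarith
  set r : ℝ := ρ⁻¹ with hr
  have hr0 : 0 ≤ r := by positivity
  have hr1 : r < 1 := inv_lt_one_of_one_lt₀ hρ1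
  have hMj := (massFactor_pos hL0 α hm2 j).le
  -- termwise bound
  have hterm : ∀ k : ℕ, ‖(ρ ^ k)⁻¹ * etaCoeff d n L α m2 (j + k)‖ ≤ c * massFactor L α m2 j * r ^ k := by
    intro k
    rw [Real.norm_eq_abs, abs_mul, abs_inv, abs_of_nonneg (by positivity : (0 : ℝ) ≤ ρ ^ k), hr, inv_pow]
    calc (ρ ^ k)⁻¹ * |etaCoeff d n L α m2 (j + k)| ≤ (ρ ^ k)⁻¹ * (c * massFactor L α m2 (j + k)) := by
          gcongr
          exact h L hL m2 hm2 hm2' (j + k)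
      _ ≤ (ρ ^ k)⁻¹ * (c * massFactor L α m2 j) := by
          gcongr
          exact massFactor_antitone hL1 hα0.le hm2 (Nat.le_add_right j k)
      _ = c * massFactor L α m2 j * (ρ ^ k)⁻¹ := by ring
  have hgeom : HasSum (fun k : ℕ => c * massFactor L α m2 j * r ^ k) (c * massFactor L α m2 j * (1 - r)⁻¹) :=
    (hasSum_geometric_of_lt_one hr0 hr1).mul_left _
  refine ⟨Summable.of_norm_bounded hgeom.summable hterm, ?_⟩
  have hbound : ‖etaGe d n L α m2 j‖ ≤ c * massFactor L α m2 j * (1 - r)⁻¹ :=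
    tsum_of_norm_bounded hgeom hterm
  rw [Real.norm_eq_abs] at hbound
  have hinv : (1 - r)⁻¹ ≤ K := by
    have e : (1 - r)⁻¹ = ρ / (ρ - 1) := by
      rw [hr]
      field_simp
    rw [e, hK, div_le_div_iff₀ (by linarith) (by linarith)]
    nlinarith
  calc |etaGe d n L α m2 j| ≤ c * massFactor L α m2 j * (1 - r)⁻¹ := hbound
    _ ≤ c * massFactor L α m2 j * K := by gcongr
    _ = c * K * massFactor L α m2 j := by ring

/-! ### Lemma 5.2.1: the bounds on `w̄_j^{(1)}`, `β_j`, `β^:_j` -/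

/-- **Lemma 5.2.1, `w̄_j^{(1)} = O(1)`** (constant depending on `L`): `|w_j^{(1)}| ≤ Σ_x|w_{j;0,x}| ≤
c L^d (L^α)^{j∧j_m}`, hence `|w̄_j^{(1)}| ≤ c L^d` for `L ≥ 2`, `m² ∈ [0,m̄²]`, all `j`.
[cite: Slade2017, Lemma 5.2.1 (bound on `w̄_j^{(1)}`); §10.2 (display (10.27))] -/
theorem abs_wbarOne_le (hd : 1 ≤ d) {α : ℝ} (hα0 : 0 < α) (hα2 : α < 2) (hαd : α < d)
    {mbar : ℝ} (hmbar : 0 ≤ mbar) :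
    ∃ c : ℝ, 0 < c ∧ ∀ L : ℝ, 2 ≤ L → ∀ m2 : ℝ, 0 ≤ m2 → m2 ≤ mbar → ∀ j : ℕ,
      |wOne d L α m2 j| ≤ c * L ^ d * (L ^ α) ^ scaleMin L α m2 j ∧
      |wbarOne d L α m2 j| ≤ c * L ^ d := by
  obtain ⟨c, hc, h⟩ := sum_abs_wCov_le hd hα0 hα2 hαd hmbar
  refine ⟨c, hc, fun L hL m2 hm2 hm2' j => ?_⟩
  have hL0 : (0 : ℝ) < L := by linarith
  have hL1 : (1 : ℝ) ≤ L := by linarith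
  have hw : |wOne d L α m2 j| ≤ c * L ^ d * (L ^ α) ^ scaleMin L α m2 j := by
    unfold wOne
    rw [powSum_eq_sum (S := ball (L ^ j / 2))
      (fun x hx => wCov_eq_zero_of_not_mem_ball hd hL1 α m2 le_rfl hx) one_ne_zero]
    simp only [pow_one]
    exact (Finset.abs_sum_le_sum_abs _ _).trans (h L hL m2 hm2 hm2' j _)
  refine ⟨hw, ?_⟩
  have hP : 0 < (L ^ α) ^ scaleMin L α m2 j := by positivity
  unfold wbarOne
  rw [abs_mul, abs_inv, abs_of_pos hP, inv_mul_le_iff₀ hP]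
  calc |wOne d L α m2 j| ≤ c * L ^ d * (L ^ α) ^ scaleMin L α m2 j := hw
    _ = (L ^ α) ^ scaleMin L α m2 j * (c * L ^ d) := by ring

/-- **`δ[w^{(2)}] = Σ_x C_{j+1;0,x}(w_{j;0,x} + w_{j+1;0,x})`** ("`w_+^{(2)} - w^{(2)} = 2(wC)^{(1)} + C^{(2)}`",
(10.28)), as finite sums over any ball containing the range of `w_{j+1}`.
[cite: Slade2017, §10.2 (display (10.28))] -/
theorem powSum_two_succ_sub (hd : 1 ≤ d) {L : ℝ} (hL : 1 ≤ L) (α m2 : ℝ) (j : ℕ) :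
    powSum (wCov d L α m2 (j + 1)) 2 - powSum (wCov d L α m2 j) 2 =
      ∑ x ∈ ball (L ^ (j + 1) / 2), fracCov d L α m2 (j + 1) x * (wCov d L α m2 j x + wCov d L α m2 (j + 1) x) := by
  rw [powSum_eq_sum (S := ball (L ^ (j + 1) / 2))
      (fun x hx => wCov_eq_zero_of_not_mem_ball hd hL α m2 le_rfl hx) two_ne_zero,
    powSum_eq_sum (S := ball (L ^ (j + 1) / 2))
      (fun x hx => wCov_eq_zero_of_not_mem_ball hd hL α m2 (Nat.le_succ j) hx) two_ne_zero,
    ← Finset.sum_sub_distrib]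
  refine Finset.sum_congr rfl fun x _ => ?_
  rw [wCov_succ]
  ring

/-- **The `ℓ¹` size of `δ_j[w_x²] = w_{j+1;0,x}² - w_{j;0,x}²`:** `Σ_{x∈S}|δ_j[w_x²]| ≤
c L^{d+α} M_j (L^ε)^{j∧j_m}` for every finite `S`, `L ≥ 2`, `m² ∈ [0,m̄²]`, `j ≥ 0`
("`w_+^{(2)} - w^{(2)} = 2(wC)^{(1)} + C^{(2)} ≤ 2Σ_xC_{j+1;0,x}Σ_{k=1}^{j+1}C_{k;0,x}`. Therefore, using the
finite range of `C_k`, `β'_j ≲ M_jL^{-(d-α)j}Σ_{k=0}^jL^{dk}M_kL^{-(d-α)k} ≲ M_jL^{-(d-α)j}L^{α(j∧j_m)} ≤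
M_jL^{ε(j∧j_m)}`"; here with absolute values inside, which is what the `ξ_j` bound reuses in (10.36)).
[cite: Slade2017, §10.2 (displays (10.28)–(10.29), (10.36))] -/
theorem sum_abs_wCov_sq_succ_sub_le (hd : 1 ≤ d) {α : ℝ} (hα0 : 0 < α) (hα2 : α < 2) (hαd : α < d)
    {mbar : ℝ} (hmbar : 0 ≤ mbar) :
    ∃ c : ℝ, 0 < c ∧ ∀ L : ℝ, 2 ≤ L → ∀ m2 : ℝ, 0 ≤ m2 → m2 ≤ mbar → ∀ j : ℕ,
      ∀ S : Finset (Site d), ∑ x ∈ S, |wCov d L α m2 (j + 1) x ^ 2 - wCov d L α m2 j x ^ 2| ≤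
        c * L ^ d * L ^ α * massFactor L α m2 j * (L ^ (2 * α - d)) ^ scaleMin L α m2 j := by
  obtain ⟨c₀, hc₀, hC⟩ := abs_fracCov_le_massFactor hd hα0 hα2 hαd hmbar
  obtain ⟨c₁, hc₁, hW⟩ := sum_abs_wCov_le hd hα0 hα2 hαd hmbar
  refine ⟨2 * c₀ * c₁, by positivity, fun L hL m2 hm2 hm2' j S => ?_⟩
  have hL0 : (0 : ℝ) < L := by linarith
  have hL1 : (1 : ℝ) ≤ L := by linarith
  set s : ℕ := scaleMin L α m2 j with hs
  set M : ℝ := massFactor L α m2 j with hM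
  have hM0 : 0 ≤ M := (massFactor_pos hL0 α hm2 j).le
  have hsj : s ≤ j := scaleMin_le L α m2 j
  have hs1 : scaleMin L α m2 (j + 1) ≤ s + 1 := scaleMin_succ_le L α m2 j
  -- the uniform bound on `C_{j+1}`
  have hsup : ∀ x, |fracCov d L α m2 (j + 1) x| ≤ c₀ * (L ^ j) ^ (α - (d : ℝ)) * M := by
    intro x
    have := hC L hL m2 hm2 hm2' (j + 1) (by omega) x
    rw [Nat.add_sub_cancel] at this
    exact this.trans (mul_le_mul_of_nonneg_left (massFactor_succ_le hL1 hα0.le hm2 j)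
      (mul_nonneg hc₀.le (Real.rpow_nonneg (by positivity) _)))
  -- the ℓ¹ bounds on `w_j`, `w_{j+1}`
  have hΛ : 1 ≤ L ^ α := Real.one_le_rpow hL1 hα0.le
  have hw : ∀ i, i ≤ j + 1 → ∑ x ∈ S, |wCov d L α m2 i x| ≤ c₁ * L ^ d * (L ^ α * (L ^ α) ^ s) := by
    intro i hi
    refine (hW L hL m2 hm2 hm2' i S).trans ?_
    have hsi : scaleMin L α m2 i ≤ s + 1 := (scaleMin_mono L α m2 hi).trans hs1
    have : (L ^ α) ^ scaleMin L α m2 i ≤ (L ^ α) ^ (s + 1) := pow_le_pow_right₀ hΛ hsi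
    rw [pow_succ'] at this
    gcongr
  -- the scaling identity `(L^j)^{α-d}(L^α)^s ≤ (L^ε)^s`
  have hscale : (L ^ j) ^ (α - (d : ℝ)) * (L ^ α) ^ s ≤ (L ^ (2 * α - d)) ^ s := by
    have e1 : (L ^ j) ^ (α - (d : ℝ)) = ((L ^ ((d : ℝ) - α)) ^ j)⁻¹ := by
      rw [← Real.rpow_natCast L j, ← Real.rpow_mul hL0.le, ← Real.rpow_natCast (L ^ ((d : ℝ) - α)) j,
        ← Real.rpow_mul hL0.le, ← Real.rpow_neg hL0.le]
      congr 1
      ring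
    have e2 : (L ^ (2 * α - d)) ^ s = ((L ^ ((d : ℝ) - α)) ^ s)⁻¹ * (L ^ α) ^ s := by
      rw [← inv_pow, ← mul_pow, ← Real.rpow_neg hL0.le, ← Real.rpow_add hL0]
      congr 1
      congr 1
      ring
    rw [e1, e2]
    have hge1 : 1 ≤ L ^ ((d : ℝ) - α) := Real.one_le_rpow hL1 (by linarith)
    have hmono : (L ^ ((d : ℝ) - α)) ^ s ≤ (L ^ ((d : ℝ) - α)) ^ j := pow_le_pow_right₀ hge1 hsj
    have hpos : 0 < (L ^ ((d : ℝ) - α)) ^ s := by positivity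
    gcongr
  have hnn : 0 ≤ c₀ * (L ^ j) ^ (α - (d : ℝ)) * M :=
    mul_nonneg (mul_nonneg hc₀.le (Real.rpow_nonneg (by positivity) _)) hM0
  calc ∑ x ∈ S, |wCov d L α m2 (j + 1) x ^ 2 - wCov d L α m2 j x ^ 2|
      = ∑ x ∈ S, |fracCov d L α m2 (j + 1) x * (wCov d L α m2 j x + wCov d L α m2 (j + 1) x)| := by
        refine Finset.sum_congr rfl fun x _ => ?_
        rw [wCov_succ]
        ring_nf
    _ ≤ ∑ x ∈ S, c₀ * (L ^ j) ^ (α - (d : ℝ)) * M * (|wCov d L α m2 j x| + |wCov d L α m2 (j + 1) x|) := by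
        refine Finset.sum_le_sum fun x _ => ?_
        rw [abs_mul]
        exact mul_le_mul (hsup x) (abs_add_le _ _) (abs_nonneg _) hnn
    _ = c₀ * (L ^ j) ^ (α - (d : ℝ)) * M *
          (∑ x ∈ S, |wCov d L α m2 j x| + ∑ x ∈ S, |wCov d L α m2 (j + 1) x|) := by
        rw [← Finset.sum_add_distrib, Finset.mul_sum]
    _ ≤ c₀ * (L ^ j) ^ (α - (d : ℝ)) * M * (c₁ * L ^ d * (L ^ α * (L ^ α) ^ s) +
          c₁ * L ^ d * (L ^ α * (L ^ α) ^ s)) :=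
        mul_le_mul_of_nonneg_left (add_le_add (hw j (Nat.le_succ j)) (hw (j + 1) le_rfl)) hnn
    _ = 2 * c₀ * c₁ * L ^ d * L ^ α * M * ((L ^ j) ^ (α - (d : ℝ)) * (L ^ α) ^ s) := by ring
    _ ≤ 2 * c₀ * c₁ * L ^ d * L ^ α * M * (L ^ (2 * α - d)) ^ s := by gcongr

/-- **Lemma 5.2.1, `β_j = O(M_j)`** (constant depending on `L`): "`β'_j ≲ M_jL^{-(d-α)j}Σ_{k≤j}
L^{dk}M_kL^{-(d-α)k} ≲ M_jL^{-(d-α)j}L^{α(j∧j_m)} ≤ M_jL^{ε(j∧j_m)}`. This proves (5.22) for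
`β_j = L^{-ε(j∧j_m)}β'_j`." Precisely: there is `c` depending on `d, n, α, m̄²` only with
`|β'_j| ≤ c L^{d+α} M_j (L^ε)^{j∧j_m}` and `|β_j| ≤ c L^{d+α} M_j` for all `L ≥ 2`, `m² ∈ [0,m̄²]`, `j ≥ 0`.
[cite: Slade2017, Lemma 5.2.1 (bound on `β_j`); §10.2 (displays (10.28)–(10.29))] -/
theorem abs_betaCoeff_le (hd : 1 ≤ d) (n : ℕ) {α : ℝ} (hα0 : 0 < α) (hα2 : α < 2) (hαd : α < d)
    {mbar : ℝ} (hmbar : 0 ≤ mbar) :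
    ∃ c : ℝ, 0 < c ∧ ∀ L : ℝ, 2 ≤ L → ∀ m2 : ℝ, 0 ≤ m2 → m2 ≤ mbar → ∀ j : ℕ,
      |betaPrime d n L α m2 j| ≤
          c * L ^ d * L ^ α * massFactor L α m2 j * (L ^ (2 * α - d)) ^ scaleMin L α m2 j ∧
      |betaCoeff d n L α m2 j| ≤ c * L ^ d * L ^ α * massFactor L α m2 j := by
  obtain ⟨c, hc, h⟩ := sum_abs_wCov_sq_succ_sub_le hd hα0 hα2 hαd hmbar
  refine ⟨(n + 8) * c, by positivity, fun L hL m2 hm2 hm2' j => ?_⟩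
  have hL0 : (0 : ℝ) < L := by linarith
  have hL1 : (1 : ℝ) ≤ L := by linarith
  set s : ℕ := scaleMin L α m2 j with hs
  set M : ℝ := massFactor L α m2 j with hM
  have hβ' : |betaPrime d n L α m2 j| ≤ (n + 8) * c * L ^ d * L ^ α * M * (L ^ (2 * α - d)) ^ s := by
    unfold betaPrime
    rw [abs_mul, abs_of_nonneg (by positivity : (0 : ℝ) ≤ (n : ℝ) + 8),
      powSum_eq_sum (S := ball (L ^ (j + 1) / 2))
        (fun x hx => wCov_eq_zero_of_not_mem_ball hd hL1 α m2 le_rfl hx) two_ne_zero,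
      powSum_eq_sum (S := ball (L ^ (j + 1) / 2))
        (fun x hx => wCov_eq_zero_of_not_mem_ball hd hL1 α m2 (Nat.le_succ j) hx) two_ne_zero,
      ← Finset.sum_sub_distrib]
    calc (n + 8) * |∑ x ∈ ball (L ^ (j + 1) / 2), (wCov d L α m2 (j + 1) x ^ 2 - wCov d L α m2 j x ^ 2)|
        ≤ (n + 8) * ∑ x ∈ ball (L ^ (j + 1) / 2), |wCov d L α m2 (j + 1) x ^ 2 - wCov d L α m2 j x ^ 2| := by
          gcongr
          exact Finset.abs_sum_le_sum_abs _ _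
      _ ≤ (n + 8) * (c * L ^ d * L ^ α * M * (L ^ (2 * α - d)) ^ s) := by
          gcongr
          exact h L hL m2 hm2 hm2' j _
      _ = (n + 8) * c * L ^ d * L ^ α * M * (L ^ (2 * α - d)) ^ s := by ring
  refine ⟨hβ', ?_⟩
  have hP : 0 < (L ^ (2 * α - d)) ^ s := by positivity
  unfold betaCoeff
  rw [abs_mul, abs_inv, abs_of_pos hP, inv_mul_le_iff₀ hP]
  calc |betaPrime d n L α m2 j| ≤ (n + 8) * c * L ^ d * L ^ α * M * (L ^ (2 * α - d)) ^ s := hβ'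
    _ = (L ^ (2 * α - d)) ^ s * ((n + 8) * c * L ^ d * L ^ α * M) := by ring

/-- **Lemma 5.2.1, `β^:_j = O(M_j)`** (constant depending on `L`): "The bound on `β^:_j` then follows
from the bounds on `η_{≥j}`, `w̄_j^{(1)}`" (and `M_{j+1} ≤ M_j`).
[cite: Slade2017, Lemma 5.2.1 (bound on `β^:_j`); §10.2] -/
theorem abs_betaWCoeff_le (hd : 1 ≤ d) (n : ℕ) {α : ℝ} (hα0 : 0 < α) (hα2 : α < 2) (hαd : α < d)
    {mbar : ℝ} (hmbar : 0 ≤ mbar) {L : ℝ} (hL : 2 ≤ L) :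
    ∃ c : ℝ, 0 < c ∧ ∀ m2 : ℝ, 0 ≤ m2 → m2 ≤ mbar → ∀ j : ℕ,
      |betaWCoeff d n L α m2 j| ≤ c * massFactor L α m2 j := by
  obtain ⟨cβ, hcβ, hβ⟩ := abs_betaCoeff_le hd n hα0 hα2 hαd hmbar
  obtain ⟨cη, hcη, hη⟩ := summable_etaGe_and_abs_le hd n hα0 hα2 hαd hmbar
  obtain ⟨cw, hcw, hw⟩ := abs_wbarOne_le hd hα0 hα2 hαd hmbar
  have hL0 : (0 : ℝ) < L := by linarith
  have hL1 : (1 : ℝ) ≤ L := by linarith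
  refine ⟨cβ * L ^ d * L ^ α + 8 * (cη * (cw * L ^ d)), by positivity, fun m2 hm2 hm2' j => ?_⟩
  have hM0 := (massFactor_pos hL0 α hm2 j).le
  have h1 := (hβ L hL m2 hm2 hm2' j).2
  have h2 := (hη L hL m2 hm2 hm2' j).2
  have h3 := (hη L hL m2 hm2 hm2' (j + 1)).2
  have h4 := (hw L hL m2 hm2 hm2' j).2
  have h5 := (hw L hL m2 hm2 hm2' (j + 1)).2
  have h6 : massFactor L α m2 (j + 1) ≤ massFactor L α m2 j := massFactor_succ_le hL1 hα0.le hm2 j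
  have e1 : |etaGe d n L α m2 j| * |wbarOne d L α m2 j| ≤ cη * massFactor L α m2 j * (cw * L ^ d) :=
    mul_le_mul h2 h4 (abs_nonneg _) (mul_nonneg hcη.le hM0)
  have e2 : |etaGe d n L α m2 (j + 1)| * |wbarOne d L α m2 (j + 1)| ≤
      cη * massFactor L α m2 j * (cw * L ^ d) :=
    mul_le_mul (h3.trans (mul_le_mul_of_nonneg_left h6 hcη.le)) h5 (abs_nonneg _)
      (mul_nonneg hcη.le hM0)
  unfold betaWCoeff betaW
  calc |betaCoeff d n L α m2 j + 4 * (etaGe d n L α m2 j * wbarOne d L α m2 j -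
          etaGe d n L α m2 (j + 1) * wbarOne d L α m2 (j + 1))|
      ≤ |betaCoeff d n L α m2 j| + 4 * (|etaGe d n L α m2 j| * |wbarOne d L α m2 j| +
          |etaGe d n L α m2 (j + 1)| * |wbarOne d L α m2 (j + 1)|) := by
        refine (abs_add_le _ _).trans ?_
        rw [abs_mul, abs_of_pos (by norm_num : (0 : ℝ) < 4)]
        refine add_le_add le_rfl (mul_le_mul_of_nonneg_left ?_ (by norm_num))
        refine (abs_sub _ _).trans ?_
        rw [abs_mul, abs_mul]
    _ ≤ cβ * L ^ d * L ^ α * massFactor L α m2 j + 4 * (cη * massFactor L α m2 j * (cw * L ^ d) +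
          cη * massFactor L α m2 j * (cw * L ^ d)) := by linarith [h1, e1, e2]
    _ = (cβ * L ^ d * L ^ α + 8 * (cη * (cw * L ^ d))) * massFactor L α m2 j := by ring

/-- **Lemma 5.2.1, the bounds (5.22) on `η_j, η_{≥j}, β_j, β^:_j, w̄_j^{(1)}` packaged** (for fixed
`L ≥ 2` and `m̄² > 0`, one constant): for all `m² ∈ [0,m̄²]` and all scales `j ≥ 0`,
`|η_j|, |η_{≥j}|, |β_j|, |β^:_j| ≤ c M_j` and `|w̄_j^{(1)}| ≤ c`. Printed: "Let `d = 1,2,3`;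
`α ∈ (½d, 2∧d)`; `j ≥ 1`; `m̄² > 0`. The following bounds hold uniformly in `m² ∈ [0,m̄²]`:
`η_j, η_{≥j}, β_j, β^:_j, ξ_j, ξ^W_j = O(M_j)`, `w̄_j^{(1)} = O(1)`, `υ_{*,j} = O(M_jL^{-dj})`. Constants in
(5.22) may depend on `L, m̄²` but not on `j`." Proved here for every `d ≥ 1`, `α ∈ (0,2)`, `α < d`,
`j ≥ 0`, for the explicit decomposition `C_j = FRD.fracCov` of `ℤ^d`; NOT treated in this file:
`ξ_j`, `ξ^W_j`, the `υ`'s, and the mass derivative (5.23).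
[cite: Slade2017, Lemma 5.2.1 (display (5.22): the bounds on `η_j, η_{≥j}, β_j, β^:_j, w̄_j^{(1)}`)]
[cite: Slade2017, §10.2 (proof of Lemma 5.2.1)] -/
theorem Slade2017_lem521_core (hd : 1 ≤ d) (n : ℕ) {α : ℝ} (hα0 : 0 < α) (hα2 : α < 2)
    (hαd : α < d) {mbar : ℝ} (hmbar : 0 ≤ mbar) {L : ℝ} (hL : 2 ≤ L) :
    ∃ c : ℝ, 0 < c ∧ ∀ m2 : ℝ, 0 ≤ m2 → m2 ≤ mbar → ∀ j : ℕ,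
      |etaCoeff d n L α m2 j| ≤ c * massFactor L α m2 j ∧
      |etaGe d n L α m2 j| ≤ c * massFactor L α m2 j ∧
      |betaCoeff d n L α m2 j| ≤ c * massFactor L α m2 j ∧
      |betaWCoeff d n L α m2 j| ≤ c * massFactor L α m2 j ∧
      |wbarOne d L α m2 j| ≤ c := by
  obtain ⟨c₁, hc₁, h₁⟩ := abs_etaCoeff_le hd n hα0 hα2 hαd hmbar
  obtain ⟨c₂, hc₂, h₂⟩ := summable_etaGe_and_abs_le hd n hα0 hα2 hαd hmbar
  obtain ⟨c₃, hc₃, h₃⟩ := abs_betaCoeff_le hd n hα0 hα2 hαd hmbar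
  obtain ⟨c₄, hc₄, h₄⟩ := abs_betaWCoeff_le hd n hα0 hα2 hαd hmbar hL
  obtain ⟨c₅, hc₅, h₅⟩ := abs_wbarOne_le hd hα0 hα2 hαd hmbar
  have hL0 : (0 : ℝ) < L := by linarith
  set c : ℝ := c₁ + c₂ + c₃ * L ^ d * L ^ α + c₄ + c₅ * L ^ d with hc
  have hA : 0 ≤ c₃ * L ^ d * L ^ α := by positivity
  have hB : 0 ≤ c₅ * L ^ d := by positivity
  refine ⟨c, by positivity, fun m2 hm2 hm2' j => ?_⟩
  have hM0 := (massFactor_pos hL0 α hm2 j).le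
  refine ⟨(h₁ L hL m2 hm2 hm2' j).trans ?_, (h₂ L hL m2 hm2 hm2' j).2.trans ?_,
    (h₃ L hL m2 hm2 hm2' j).2.trans ?_, (h₄ m2 hm2 hm2' j).trans ?_, (h₅ L hL m2 hm2 hm2' j).2.trans ?_⟩
  · exact mul_le_mul_of_nonneg_right (by rw [hc]; linarith) hM0
  · exact mul_le_mul_of_nonneg_right (by rw [hc]; linarith) hM0
  · exact mul_le_mul_of_nonneg_right (by rw [hc]; linarith) hM0
  · exact mul_le_mul_of_nonneg_right (by rw [hc]; linarith) hM0
  · rw [hc]; linarith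

/-! ### Lemma 5.2.1: continuity in `m²` -/

/-- `m² ↦ w_{j;0,x}(m²)` is continuous (a finite sum of the continuous `C_{i;0,x}(m²)`,
Proposition 3.3.1). [cite: Slade2017, Lemma 5.2.1 (continuity in m²) and Proposition 3.3.1] -/
theorem continuous_wCov_mass (hd : 1 ≤ d) {α : ℝ} (hα0 : 0 < α) (hα2 : α < 2) {L : ℝ} (hL : 2 ≤ L)
    (j : ℕ) (x : Site d) : Continuous fun m2 : ℝ => wCov d L α m2 j x := by
  unfold wCov
  exact continuous_finsetSum _ fun i hi =>
    continuous_fracCov_mass hd hα0 hα2 hL (Finset.mem_Icc.mp hi).1 x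

/-- `m² ↦ w_j^{(p)}(m²)` is continuous for `p ≥ 1` (a finite sum over the fixed range `|x|₁ < ½L^j`).
[cite: Slade2017, Lemma 5.2.1 (continuity in m²)] -/
theorem continuous_powSum_wCov_mass (hd : 1 ≤ d) {α : ℝ} (hα0 : 0 < α) (hα2 : α < 2) {L : ℝ}
    (hL : 2 ≤ L) (j : ℕ) {p : ℕ} (hp : p ≠ 0) :
    Continuous fun m2 : ℝ => powSum (wCov d L α m2 j) p := by
  have hL1 : (1 : ℝ) ≤ L := by linarith
  have e : (fun m2 : ℝ => powSum (wCov d L α m2 j) p) =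
      fun m2 => ∑ x ∈ ball (L ^ j / 2), wCov d L α m2 j x ^ p := by
    funext m2
    exact powSum_eq_sum (fun x hx => wCov_eq_zero_of_not_mem_ball hd hL1 α m2 le_rfl hx) hp
  rw [e]
  exact continuous_finsetSum _ fun x _ => (continuous_wCov_mass hd hα0 hα2 hL j x).pow p

/-- `m² ↦ η_j(m²)` is continuous on `ℝ`. [cite: Slade2017, Lemma 5.2.1 (continuity in m²)] -/
theorem continuous_etaCoeff_mass (hd : 1 ≤ d) (n : ℕ) {α : ℝ} (hα0 : 0 < α) (hα2 : α < 2) {L : ℝ}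
    (hL : 2 ≤ L) (j : ℕ) : Continuous fun m2 : ℝ => etaCoeff d n L α m2 j := by
  unfold etaCoeff etaPrime
  exact continuous_const.mul (continuous_const.mul (continuous_fracCov_mass hd hα0 hα2 hL (by omega) 0))

/-- `m² ↦ η_{≥j}(m²)` is continuous on `[0,m̄²]` (uniform convergence of (5.20): the terms are
bounded by `c L^{-(d-α)k}` there). [cite: Slade2017, Lemma 5.2.1 (continuity in m²)] -/
theorem continuousOn_etaGe_mass (hd : 1 ≤ d) (n : ℕ) {α : ℝ} (hα0 : 0 < α) (hα2 : α < 2)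
    (hαd : α < d) {mbar : ℝ} (hmbar : 0 ≤ mbar) {L : ℝ} (hL : 2 ≤ L) (j : ℕ) :
    ContinuousOn (fun m2 : ℝ => etaGe d n L α m2 j) (Icc 0 mbar) := by
  obtain ⟨c, hc, h⟩ := abs_etaCoeff_le hd n hα0 hα2 hαd hmbar
  have hL0 : (0 : ℝ) < L := by linarith
  have hL1 : (1 : ℝ) < L := by linarith
  have hdα : 0 < (d : ℝ) - α := by linarith
  set ρ : ℝ := L ^ ((d : ℝ) - α) with hρ
  have hρ1 : 1 < ρ := Real.one_lt_rpow hL1 hdα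
  have hρ0 : 0 < ρ := by linarith
  have hr0 : 0 ≤ ρ⁻¹ := by positivity
  have hr1 : ρ⁻¹ < 1 := inv_lt_one_of_one_lt₀ hρ1
  unfold etaGe
  refine continuousOn_tsum (u := fun k : ℕ => c * (ρ⁻¹) ^ k)
    (fun k => (continuous_const.mul (continuous_etaCoeff_mass hd n hα0 hα2 hL (j + k))).continuousOn)
    ((summable_geometric_of_lt_one hr0 hr1).mul_left c) fun k m2 hm2 => ?_
  rw [Real.norm_eq_abs, abs_mul, abs_inv, abs_of_nonneg (by positivity : (0 : ℝ) ≤ ρ ^ k), ← inv_pow]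
  calc (ρ⁻¹) ^ k * |etaCoeff d n L α m2 (j + k)| ≤ (ρ⁻¹) ^ k * (c * massFactor L α m2 (j + k)) := by
        gcongr
        exact h L hL m2 hm2.1 hm2.2 (j + k)
    _ ≤ (ρ⁻¹) ^ k * (c * 1) := by
        gcongr
        exact massFactor_le_one hL0 α hm2.1 (j + k)
    _ = c * (ρ⁻¹) ^ k := by ring

/-- `m² ↦ w_j^{(1)}(m²)` and `m² ↦ β'_j(m²)` are continuous on `ℝ` (unrescaled coefficients).
[cite: Slade2017, Lemma 5.2.1 (continuity in m²)] -/
theorem continuous_wOne_betaPrime_mass (hd : 1 ≤ d) (n : ℕ) {α : ℝ} (hα0 : 0 < α) (hα2 : α < 2)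
    {L : ℝ} (hL : 2 ≤ L) (j : ℕ) :
    (Continuous fun m2 : ℝ => wOne d L α m2 j) ∧ Continuous fun m2 : ℝ => betaPrime d n L α m2 j := by
  refine ⟨continuous_powSum_wCov_mass hd hα0 hα2 hL j one_ne_zero, ?_⟩
  unfold betaPrime
  exact continuous_const.mul ((continuous_powSum_wCov_mass hd hα0 hα2 hL (j + 1) two_ne_zero).sub
    (continuous_powSum_wCov_mass hd hα0 hα2 hL j two_ne_zero))

/-- **Below the mass scale the rescaling exponents are constant in `m²`:** for `m² < L^{-α(j-1)}`
one has `j_m ≥ j + 1` (indeed `j_m = ⌈f_m⌉ ≥ j+1 ⟺ f_m > j ⟺ m² < L^{-α(j-1)}`), so `j ∧ j_m = j`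
and `(j+1) ∧ j_m = j+1` (and trivially so for `m² ≤ 0`). [cite: Slade2017, §3.4 (the mass scale)] -/
theorem scaleMin_eq_of_lt {L α m2 : ℝ} (hL : 1 < L) (hα : 0 < α) {j : ℕ}
    (hm : m2 < L ^ (-(α * ((j : ℝ) - 1)))) :
    scaleMin L α m2 j = j ∧ scaleMin L α m2 (j + 1) = j + 1 := by
  by_cases hm0 : 0 < m2
  · have hL0 : 0 < L := by linarith
    have hlogL : 0 < Real.log L := Real.log_pos hL
    have hjm : j + 1 ≤ massScale L α m2 := by
      unfold massScale
      refine Nat.succ_le_of_lt ((Nat.lt_ceil).mpr ?_)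
      unfold massScaleReal
      have h1 : Real.log m2 < -(α * ((j : ℝ) - 1)) * Real.log L := by
        have := Real.log_lt_log hm0 hm
        rwa [Real.log_rpow hL0] at this
      have h2 : Real.log m2⁻¹ = -Real.log m2 := Real.log_inv m2
      have h3 : (j : ℝ) - 1 < -Real.log m2 / (α * Real.log L) := by
        rw [lt_div_iff₀ (mul_pos hα hlogL)]
        nlinarith
      rw [h2]
      linarith
    exact ⟨scaleMin_eq_self fun _ => (Nat.le_succ j).trans hjm, scaleMin_eq_self fun _ => hjm⟩
  · exact ⟨scaleMin_of_not_pos hm0 j, scaleMin_of_not_pos hm0 (j + 1)⟩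

/-- **Continuity of `β_j`, `w̄_j^{(1)}`, `w̄_{j+1}^{(1)}` in `m²` below the mass scale**: on
`m² < L^{-α(j-1)}` (where `j + 1 ≤ j_m`) the rescaled coefficients are constant multiples of the
continuous unrescaled ones. (The printed "Each of the left-hand sides in (5.22) is continuous in
`m² ∈ [0,m̄²]`" is used, in the proof of Lemma 7.2.1, only at scales `j ≤ j_{m̃}+1 < j_m`; as
functions of `m²` at FIXED `j` the rescaled coefficients jump where `j ∧ j_m(m²)` jumps, so the
continuity is stated here on the sub-interval below the mass scale.)
[cite: Slade2017, Lemma 5.2.1 (continuity in m²) and Lemma 7.2.1 (proof: "the nonzero T_j have j ≤ j_{m̃}+1 < j_m")] -/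
theorem continuousOn_rescaled_mass (hd : 1 ≤ d) (n : ℕ) {α : ℝ} (hα0 : 0 < α) (hα2 : α < 2)
    {L : ℝ} (hL : 2 ≤ L) (j : ℕ) :
    ContinuousOn (fun m2 : ℝ => betaCoeff d n L α m2 j) (Iio (L ^ (-(α * ((j : ℝ) - 1))))) ∧
    ContinuousOn (fun m2 : ℝ => wbarOne d L α m2 j) (Iio (L ^ (-(α * ((j : ℝ) - 1))))) ∧
    ContinuousOn (fun m2 : ℝ => wbarOne d L α m2 (j + 1)) (Iio (L ^ (-(α * ((j : ℝ) - 1))))) := by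
  have hL1 : (1 : ℝ) < L := by linarith
  obtain ⟨hw, hβ⟩ := continuous_wOne_betaPrime_mass hd n hα0 hα2 hL j
  have hw1 := (continuous_wOne_betaPrime_mass hd n hα0 hα2 hL (j + 1)).1
  have c1 : Continuous fun m2 : ℝ => ((L ^ (2 * α - d)) ^ j)⁻¹ * betaPrime d n L α m2 j :=
    continuous_const.mul hβ
  have c2 : Continuous fun m2 : ℝ => ((L ^ α) ^ j)⁻¹ * wOne d L α m2 j := continuous_const.mul hw
  have c3 : Continuous fun m2 : ℝ => ((L ^ α) ^ (j + 1))⁻¹ * wOne d L α m2 (j + 1) :=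
    continuous_const.mul hw1
  refine ⟨c1.continuousOn.congr fun m2 hm2 => ?_, c2.continuousOn.congr fun m2 hm2 => ?_,
    c3.continuousOn.congr fun m2 hm2 => ?_⟩
  · show betaCoeff d n L α m2 j = ((L ^ (2 * α - d)) ^ j)⁻¹ * betaPrime d n L α m2 j
    rw [betaCoeff, (scaleMin_eq_of_lt hL1 hα0 hm2).1]
  · show wbarOne d L α m2 j = ((L ^ α) ^ j)⁻¹ * wOne d L α m2 j
    rw [wbarOne, (scaleMin_eq_of_lt hL1 hα0 hm2).1]
  · show wbarOne d L α m2 (j + 1) = ((L ^ α) ^ (j + 1))⁻¹ * wOne d L α m2 (j + 1)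
    rw [wbarOne, (scaleMin_eq_of_lt hL1 hα0 hm2).2]

/-- **Lemma 5.2.1, continuity of `β^:_j` (and `β_j`) in `m²` below the mass scale** — the input
"the continuity of `β^:, β` … due to Lemma 5.2.1" of Lemma 7.2.1: `m² ↦ β^:_j(m²)` is continuous on
`[0, L^{-α(j-1)})`, the masses for which `j + 1 ≤ j_m`.
[cite: Slade2017, Lemma 5.2.1 (continuity in m²); Lemma 7.2.1 (proof)] -/
theorem continuousOn_betaWCoeff_mass (hd : 1 ≤ d) (n : ℕ) {α : ℝ} (hα0 : 0 < α) (hα2 : α < 2)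
    (hαd : α < d) {L : ℝ} (hL : 2 ≤ L) (j : ℕ) :
    ContinuousOn (fun m2 : ℝ => betaWCoeff d n L α m2 j) (Ico 0 (L ^ (-(α * ((j : ℝ) - 1))))) := by
  have hL0 : (0 : ℝ) < L := by linarith
  set T : ℝ := L ^ (-(α * ((j : ℝ) - 1))) with hT
  have hT0 : 0 ≤ T := (Real.rpow_pos_of_pos hL0 _).le
  obtain ⟨hβ, hw0, hw1⟩ := continuousOn_rescaled_mass hd n hα0 hα2 hL j
  have hη0 := (continuousOn_etaGe_mass hd n hα0 hα2 hαd hT0 hL j).mono (Ico_subset_Icc_self : Ico 0 T ⊆ Icc 0 T)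
  have hη1 := (continuousOn_etaGe_mass hd n hα0 hα2 hαd hT0 hL (j + 1)).mono
    (Ico_subset_Icc_self : Ico 0 T ⊆ Icc 0 T)
  have hβ' := hβ.mono (Ico_subset_Iio_self : Ico 0 T ⊆ Iio T)
  have hw0' := hw0.mono (Ico_subset_Iio_self : Ico 0 T ⊆ Iio T)
  have hw1' := hw1.mono (Ico_subset_Iio_self : Ico 0 T ⊆ Iio T)
  unfold betaWCoeff betaW
  exact hβ'.add (continuousOn_const.mul ((hη0.mul hw0').sub (hη1.mul hw1')))

end PT

end LongRangePhi4

end Literature.Barriers.CriticalPhenomena
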